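import Summits.AnomalousDissipation.AnomalousDissipation.Theorems.BaireTransferRobustLoudUpgradeStubLsFamilyA
import Summits.AnomalousDissipation.AnomalousDissipation.Theorems.BaireTransferRobustLoudUpgradeStubLsTransfer

/-!
# Stub `stub_lsIndefinite` of the line `malkin-cone-group-orbits` (crux stmt-AnomalousDissipation-1144, companion c2),
# part A: reading classical SOLVABILITY hypotheses on the steady Fourier lattice

Lattice-level helper layer (pure proof file) for the invisible-saddle stub.  For the lattice linearisation `T` of a
steady state `u₀` (given through its coordinate formula, hypothesis `hTcoe`, exactly the `hTcoe` of `…StubLsFamilyB.lean`):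

* `T_coords_of_linNSResolventRel` — a REAL classical solution `w` of `L(ν,u₀) w = G` has state vector `x` with
  `(T x)(k) = −Π_k Ĝ(k)` (`LsTransfer.latticeEq_of_linNSResolventRel`);
* `T_state_eq_forceVec` — the linear RESPONSE: `L(ν,u₀) w_d = −f_d` ⇒ `T x_d = Fm d`;
* `psi_B_eq_of_solvable` — the SIGN dictionary: if `L(ν,u₀) w = −((Z·∇)Z + α h)` is classically solvable (real `w`) then
  `ψ (B z z) = α` for the state vector `z` of `Z`, every functional `ψ` vanishing on `range T` with `ψ e = −1`
  (`e` = coefficient vector of `h`): the cokernel value of the quadratic self-interaction is read off solvability.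

References: Kielhöfer 2012 §I.2, §I.16; Temam 1979 Ch. II §1.
-/

-- `Summit.<Summit>.<Problem>` is the tree's mandated summit-side namespace (CONVENTIONS §2); for this
-- single-conjunct summit the two coincide, so the duplicate is deliberate.
set_option linter.dupNamespace false

noncomputable section

open scoped BigOperators Topology ENNReal NNReal InnerProductSpace ComplexConjugate
open Filter Set Function TopologicalSpace MeasureTheory UnitAddTorus

namespace Summit.AnomalousDissipation.AnomalousDissipation.Theorems.RobustLoudUpgrade.LsIndefinite

open Literature.Analysis.FunctionSpaces Literature.Analysis.FunctionSpaces.Torus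
open Literature.Analysis.FunctionSpaces.EuclideanSpace
open Literature.Analysis.FluidPDE
open Literature.Analysis.FluidPDE.ScalarFourier
open Literature.Analysis.FluidPDE.SteadyLattice
open Summit.AnomalousDissipation.AnomalousDissipation.Theses.BaireTransfer
open Summit.AnomalousDissipation.AnomalousDissipation.Theorems.RobustLoudUpgrade.SteadyPersist
open Summit.AnomalousDissipation.AnomalousDissipation.Theorems.RobustLoudUpgrade.LsFamily


/-! ## §0 First-order identities of a bordered implicit family (abstract) -/

section Abstract

variable {X Y P : Type*} [NormedAddCommGroup X] [NormedSpace ℝ X] [NormedAddCommGroup Y] [NormedSpace ℝ Y]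
  [NormedAddCommGroup P] [NormedSpace ℝ P]

/-- **Differentiating the bordered family identities**: if `N (υ q) + frc q.1 − σ q • e = 0` and `φ (υ q − u₀) = q.2` on a
ball around `(c, 0)` and `N, υ, σ` are differentiable at the base point, then for every direction `w'`,
`T (Dυ w') + frc w'.1 − (ℓ w') • e = 0` and `φ (Dυ w') = w'.2`. [folklore] -/
theorem family_first_order (N : X → Y) (T : X →L[ℝ] Y) (frc : P →L[ℝ] Y) (e : Y) (φ : X →L[ℝ] ℝ) (σ : P × ℝ → ℝ)
    (υ : P × ℝ → X) (ℓ : P × ℝ →L[ℝ] ℝ) (Dυ : P × ℝ →L[ℝ] X) (u₀ : X) (c : P) {r : ℝ} (hr : 0 < r)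
    (hN : HasFDerivAt N T (υ (c, 0))) (hυd : HasFDerivAt υ Dυ (c, 0)) (hσℓ : HasFDerivAt σ ℓ (c, 0))
    (hsol : ∀ q ∈ Metric.ball ((c, 0) : P × ℝ) r, N (υ q) + frc q.1 - σ q • e = 0 ∧ φ (υ q - u₀) = q.2)
    (w' : P × ℝ) : T (Dυ w') + frc w'.1 - (ℓ w') • e = 0 ∧ φ (Dυ w') = w'.2 := by
  have hball0 : Metric.ball ((c, 0) : P × ℝ) r ∈ 𝓝 ((c, 0) : P × ℝ) := Metric.ball_mem_nhds _ hr
  have hF₁ : HasFDerivAt (fun q : P × ℝ => N (υ q) + frc q.1 - σ q • e)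
      (T.comp Dυ + frc.comp (ContinuousLinearMap.fst ℝ P ℝ) - ℓ.smulRight e) (c, 0) :=
    ((hN.comp (c, 0) hυd).add ((frc.hasFDerivAt).comp (c, 0) hasFDerivAt_fst)).sub (hσℓ.smul_const e)
  have hZ₁ : HasFDerivAt (fun q : P × ℝ => N (υ q) + frc q.1 - σ q • e) (0 : P × ℝ →L[ℝ] Y) (c, 0) :=
    (hasFDerivAt_const (0 : Y) (c, 0)).congr_of_eventuallyEq
      (Filter.mem_of_superset hball0 fun q hq => (hsol q hq).1)
  have hE₁ := congrArg (fun L : P × ℝ →L[ℝ] Y => L w') (hF₁.unique hZ₁)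
  have hF₂ : HasFDerivAt (fun q : P × ℝ => φ (υ q - u₀) - q.2) (φ.comp Dυ - ContinuousLinearMap.snd ℝ P ℝ) (c, 0) :=
    ((φ.hasFDerivAt).comp (c, 0) (hυd.sub_const u₀)).sub hasFDerivAt_snd
  have hZ₂ : HasFDerivAt (fun q : P × ℝ => φ (υ q - u₀) - q.2) (0 : P × ℝ →L[ℝ] ℝ) (c, 0) :=
    (hasFDerivAt_const (0 : ℝ) (c, 0)).congr_of_eventuallyEq
      (Filter.mem_of_superset hball0 fun q hq => by
        show φ (υ q - u₀) - q.2 = 0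
        rw [(hsol q hq).2, sub_self])
  have hE₂ := congrArg (fun L : P × ℝ →L[ℝ] ℝ => L w') (hF₂.unique hZ₂)
  simp only [add_apply, sub_apply, ContinuousLinearMap.comp_apply, ContinuousLinearMap.smulRight_apply, zero_apply,
    ContinuousLinearMap.coe_fst', ContinuousLinearMap.coe_snd'] at hE₁ hE₂
  exact ⟨hE₁, sub_eq_zero.1 hE₂⟩

end Abstract

section Lattice

variable {S : Finset (Fin 3 → ℤ)} {ν : ℝ} {u₀ : UnitAddTorus (Fin 3) → EuclideanSpace ℝ (Fin 3)}
  {W : Submodule ℝ (lp (fun _ : Fin 3 → ℤ => EuclideanSpace ℂ (Fin 3)) 2)}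
  (hW : ∀ x : (lp (fun _ : Fin 3 → ℤ => EuclideanSpace ℂ (Fin 3)) 2), x ∈ W ↔ ((x : (Fin 3 → ℤ) → (EuclideanSpace ℂ
      (Fin 3))) 0 = 0 ∧ (∀ k : (Fin 3 → ℤ), (∑ jj : Fin 3, ((k jj : ℤ) : ℂ) * ((x : (Fin 3 → ℤ) → (EuclideanSpace ℂ
      (Fin 3))) k) jj) = 0) ∧
    IsConjSymm (x : (Fin 3 → ℤ) → (EuclideanSpace ℂ (Fin 3)))))
  {T : W →L[ℝ] W}
  (hTcoe : ∀ (w : W) (k : (Fin 3 → ℤ)), (((T w : W) : (lp (fun _ : Fin 3 → ℤ => EuclideanSpace ℂ (Fin 3)) 2)) :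
      (Fin 3 → ℤ) → (EuclideanSpace ℂ (Fin 3))) k =
      (((4 * Real.pi ^ 2 * ν : ℝ)) : ℂ) • ((w : (lp (fun _ : Fin 3 → ℤ => EuclideanSpace ℂ (Fin 3)) 2)) : (Fin 3 → ℤ)
          → (EuclideanSpace ℂ (Fin 3))) k +
        Torus.lerayCoeff k ((WithLp.toLp 2 (fun pp : Fin 3 => transportSym (fun jj mm => (mFourierCoeff (complexify ∘
            u₀)) mm jj) (fun mm => (((fun mm : Fin 3 → ℤ => (((freqNormSq mm)⁻¹ : ℝ) : ℂ)) • (((w : (lp (fun _ : Fin 3 →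
            ℤ => EuclideanSpace ℂ (Fin 3)) 2)) : (Fin 3 → ℤ) → (EuclideanSpace ℂ (Fin 3))) : (Fin 3 → ℤ) → EuclideanSpace
            ℂ (Fin 3)))) mm pp) k) : EuclideanSpace ℂ (Fin 3)) + (WithLp.toLp 2 (fun pp : Fin 3 => transportSym (fun jj
            mm => (((fun mm : Fin 3 → ℤ => (((freqNormSq mm)⁻¹ : ℝ) : ℂ)) • (((w : (lp (fun _ : Fin 3 → ℤ =>
            EuclideanSpace ℂ (Fin 3)) 2)) : (Fin 3 → ℤ) → (EuclideanSpace ℂ (Fin 3))) : (Fin 3 → ℤ) → EuclideanSpace ℂ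
            (Fin 3)))) mm jj) (fun mm => (mFourierCoeff (complexify ∘ u₀)) mm pp) k) : EuclideanSpace ℂ (Fin 3))))
include hW hTcoe

omit hW hTcoe in
/-- Complexification spelled two ways. [folklore] -/
private theorem cplx_eq (u : UnitAddTorus (Fin 3) → EuclideanSpace ℝ (Fin 3)) : cplx u = complexify ∘ u := by
  funext y; simp only [cplx, Function.comp_apply, realToComplex_eq_complexify]

omit hW hTcoe in
/-- Two elements of `W` with the same coordinates coincide. [folklore] -/
theorem eq_of_coords {x y : W} (h : ∀ k, (((x : W) : (lp (fun _ : Fin 3 → ℤ => EuclideanSpace ℂ (Fin 3)) 2)) : (Fin 3 →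
    ℤ) → (EuclideanSpace ℂ (Fin 3))) k = (((y : W) : (lp (fun _ : Fin 3 → ℤ => EuclideanSpace ℂ (Fin 3)) 2)) : (Fin 3 → ℤ)
    → (EuclideanSpace ℂ (Fin 3))) k) : x = y :=
  Subtype.ext (lp.ext (funext h))

/-- **Coordinates of `T` on the state vector of a classical solution**: if the real field `w` with `cf x = 𝓕(complexify ∘ w)`
solves `L(ν,u₀) w = G` classically, then `(T x)(k) = −Π_k Ĝ(k)`. [folklore] -/
theorem T_coords_of_linNSResolventRel (hu₀ : IsSmooth u₀) {w : UnitAddTorus (Fin 3) → EuclideanSpace ℝ (Fin 3)}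
    {G : UnitAddTorus (Fin 3) → EuclideanSpace ℂ (Fin 3)} (x : W)
    (hx : ((fun mm : Fin 3 → ℤ => (((freqNormSq mm)⁻¹ : ℝ) : ℂ)) • (((x : (lp (fun _ : Fin 3 → ℤ => EuclideanSpace ℂ
        (Fin 3)) 2)) : (Fin 3 → ℤ) → (EuclideanSpace ℂ (Fin 3))) : (Fin 3 → ℤ) → EuclideanSpace ℂ (Fin 3))) =
        mFourierCoeff (complexify ∘ w))
    (h : Torus.LinNSResolventRel ν u₀ 0 (cplx w) G) (k : Fin 3 → ℤ) :
    (((T x : W) : (lp (fun _ : Fin 3 → ℤ => EuclideanSpace ℂ (Fin 3)) 2)) : (Fin 3 → ℤ) → (EuclideanSpace ℂ (Fin 3))) k =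
      -Torus.lerayCoeff k (mFourierCoeff G k) := by
  rw [cplx_eq] at h
  have h1 := LsTransfer.latticeEq_of_linNSResolventRel hu₀ h k
  rw [← hx] at h1
  rw [hTcoe, smul_eq_weight_smul_cf (W_zero hW x) k]
  exact h1

/-- **The linear response on the lattice**: if `L(ν,u₀) w_d = −f_d` classically (real `w_d`) then the state vector `x_d` of `w_d`
satisfies `T x_d = Fm d`. [folklore] -/
theorem T_state_eq_forceVec (hu₀ : IsSmooth u₀) {Fm : Coeff S →ₗ[ℝ] W}
    (hFm : ∀ c' : Coeff S, (((Fm c' : W) : (lp (fun _ : Fin 3 → ℤ => EuclideanSpace ℂ (Fin 3)) 2)) : (Fin 3 → ℤ) →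
        (EuclideanSpace ℂ (Fin 3))) = mFourierCoeff (complexify ∘ force S c'))
    {d : Coeff S} {wd : UnitAddTorus (Fin 3) → EuclideanSpace ℝ (Fin 3)} (xd : W)
    (hxd : ((fun mm : Fin 3 → ℤ => (((freqNormSq mm)⁻¹ : ℝ) : ℂ)) • (((xd : (lp (fun _ : Fin 3 → ℤ => EuclideanSpace ℂ
        (Fin 3)) 2)) : (Fin 3 → ℤ) → (EuclideanSpace ℂ (Fin 3))) : (Fin 3 → ℤ) → EuclideanSpace ℂ (Fin 3))) =
        mFourierCoeff (complexify ∘ wd))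
    (hresp : Torus.LinNSResolventRel ν u₀ 0 (cplx wd) (cplx (fun y => -force S d y))) : T xd = Fm d := by
  refine eq_of_coords fun k => ?_
  rw [T_coords_of_linNSResolventRel hW hTcoe hu₀ xd hxd hresp k, hFm, cplx_eq]
  have e1 : (complexify ∘ fun y => -force S d y) = (-1 : ℂ) • (complexify ∘ force S d) := by
    funext y; simp
  rw [e1, mFourierCoeff_const_smul, lerayCoeff_smul', lerayCoeff_forceCoeff, neg_one_smul, neg_neg]

/-- **The sign dictionary**: if `L(ν,u₀) w = −((Z·∇)Z + α h)` is classically solvable by a real admissible `w`, then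
`ψ (B z z) = α` for the state vector `z` of the real smooth field `Z`, every real functional `ψ` killing `range T` with
`ψ e = −1`, `e` the coefficient vector of the admissible field `h`, and `B` the lattice bilinear map. [folklore] -/
theorem psi_B_eq_of_solvable (hu₀ : IsSmooth u₀) {B : W → W → W}
    (hB : ∀ x y : W, (((B x y : W) : (lp (fun _ : Fin 3 → ℤ => EuclideanSpace ℂ (Fin 3)) 2)) : (Fin 3 → ℤ) →
        (EuclideanSpace ℂ (Fin 3))) = fun k =>
      Torus.lerayCoeff k ((WithLp.toLp 2 (fun pp : Fin 3 => transportSym (fun jj mm => (((fun mm : Fin 3 →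
          ℤ => (((freqNormSq mm)⁻¹ : ℝ) : ℂ)) • (((x : (lp (fun _ : Fin 3 → ℤ => EuclideanSpace ℂ (Fin 3)) 2)) : (Fin
          3 → ℤ) → (EuclideanSpace ℂ (Fin 3))) : (Fin 3 → ℤ) → EuclideanSpace ℂ (Fin 3)))) mm jj) (fun mm => (((fun
          mm : Fin 3 → ℤ => (((freqNormSq mm)⁻¹ : ℝ) : ℂ)) • (((y : (lp (fun _ : Fin 3 → ℤ => EuclideanSpace ℂ (Fin
          3)) 2)) : (Fin 3 → ℤ) → (EuclideanSpace ℂ (Fin 3))) : (Fin 3 → ℤ) → EuclideanSpace ℂ (Fin 3)))) mm pp) k) :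
          EuclideanSpace ℂ (Fin 3))))
    {h : UnitAddTorus (Fin 3) → EuclideanSpace ℝ (Fin 3)} (hh₁ : IsSmooth h) (hh₂ : IsDivFree h) (hh₃ : HasZeroMean h)
    (e : W) (he : ((e : (lp (fun _ : Fin 3 → ℤ => EuclideanSpace ℂ (Fin 3)) 2)) : (Fin 3 → ℤ) → (EuclideanSpace ℂ
        (Fin 3))) = mFourierCoeff (complexify ∘ h))
    (ψ : W →L[ℝ] ℝ) (hψT : ∀ x, ψ (T x) = 0) (hψe : ψ e = -1)
    {Z : UnitAddTorus (Fin 3) → EuclideanSpace ℝ (Fin 3)} (hZ : IsSmooth Z) (z : W)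
    (hz : ((fun mm : Fin 3 → ℤ => (((freqNormSq mm)⁻¹ : ℝ) : ℂ)) • (((z : (lp (fun _ : Fin 3 → ℤ => EuclideanSpace ℂ
        (Fin 3)) 2)) : (Fin 3 → ℤ) → (EuclideanSpace ℂ (Fin 3))) : (Fin 3 → ℤ) → EuclideanSpace ℂ (Fin 3))) =
        mFourierCoeff (complexify ∘ Z))
    {α : ℝ} {w : UnitAddTorus (Fin 3) → EuclideanSpace ℝ (Fin 3)} (hw₁ : IsSmooth w) (hw₂ : IsDivFree w)
    (hw₃ : HasZeroMean w)
    (hsolv : Torus.LinNSResolventRel ν u₀ 0 (cplx w) (cplx (fun y => -(Torus.convect Z Z y + α • h y)))) :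
    ψ (B z z) = α := by
  obtain ⟨x, hx⟩ := exists_stateVec hW hw₁ hw₂ hw₃
  -- `T x = B z z + α • e`, coordinatewise
  have hTx : T x = B z z + α • e := by
    refine eq_of_coords fun k => ?_
    rw [T_coords_of_linNSResolventRel hW hTcoe hu₀ x hx hsolv k, coeW_add, coeW_smul, Pi.add_apply, Pi.smul_apply, hB,
      he, hz, cplx_eq]
    have e1 : (complexify ∘ fun y => -(Torus.convect Z Z y + α • h y)) =
        (-1 : ℂ) • ((complexify ∘ Torus.convect Z Z) + (α : ℂ) • (complexify ∘ h)) := by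
      funext y
      simp only [Function.comp_apply, Pi.smul_apply, Pi.add_apply, map_neg, map_add, ← coe_smul_complexify, neg_one_smul]
    rw [e1, mFourierCoeff_const_smul, mFourierCoeff_add (hZ.convect hZ).complexify_comp.integrable
      (hh₁.complexify_comp.integrable.smul (α : ℂ)), mFourierCoeff_const_smul, lerayCoeff_smul', neg_one_smul, neg_neg,
      lerayCoeff_add', lerayCoeff_smul', lerayCoeff_coeff hh₁ hh₂ hh₃, mFourierCoeff_convect_real hZ hZ, Complex.coe_smul]
  have h1 := hψT x
  rw [hTx, map_add, map_smul, hψe, smul_eq_mul, mul_neg, mul_one] at h1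
  linarith

end Lattice


/-! ## The registered part-A sub-goal -/

/-- **Registered sub-goal `lsIndefinite_partA`** (part file of `stub_lsIndefinite`): `eq_of_coords` in Pi-form. [folklore] -/
theorem lsIndefinite_partA : ∀ (W : Submodule ℝ (lp (fun _ : Fin 3 → ℤ => EuclideanSpace ℂ (Fin 3)) 2)) (x y : W), (∀ k : Fin 3 → ℤ, ((x : lp (fun _ : Fin 3 → ℤ => EuclideanSpace ℂ (Fin 3)) 2) : (Fin 3 → ℤ) → EuclideanSpace ℂ (Fin 3)) k = ((y : lp (fun _ : Fin 3 → ℤ => EuclideanSpace ℂ (Fin 3)) 2) : (Fin 3 → ℤ) → EuclideanSpace ℂ (Fin 3)) k) → x = y :=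
  fun _ _ _ h => Subtype.ext (lp.ext (funext h))

end Summit.AnomalousDissipation.AnomalousDissipation.Theorems.RobustLoudUpgrade.LsIndefinite

end
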